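import Mathlib
import Summits.Ventures.DiscreteObjects.Mahler.Height1Ladder
import Summits.Ventures.DiscreteObjects.Mahler.Height1CensusCellList

/-!
# Cells of the sub-Lehmer census at an arbitrary height bound `h` (venture `DiscreteObjects`, target L)

Cell `pub-namedobj`, seat `pub-namedobj-mahler` (gen 6). Framing: lottery ticket; floor = certified
bounds/negative ranges.

Height-generic form of `Height1CensusCells` / `Height1Ladder`: the structure theorem
(`subLehmer_degree_le_60_structure`) does not see the height, and `height (± x^a · R) = height R`, so for
EVERY height bound `h` the statement "no integer polynomial of degree `≤ N` (`N ≤ 60`) and height `≤ h` is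
sub-Lehmer" (`HeightSubLehmerEmptyUpTo h N`, typed) follows — conditional on [MRW08, Thm 1.1] and
Smyth's theorem — from the cells `HeightCell h s d` with `(s, d)` admissible and `Σ φ(s) + d ≤ N`
(`heightSubLehmerEmptyUpTo_of_cells`).  At `h = 1` these are the cells of `Height1CensusCells`
(`heightCell_one_iff`, `heightSubLehmerEmptyUpTo_one_iff`).  Use: the cell's menu line "height ≤ 2,
degree 56" is the single cell `HeightCell 2 0 56` (`heightSubLehmerEmptyUpTo_56_of_cell`); its census
run uses the same 17 certified sub-case boxes as family L6c (the boxes do not depend on the height;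
file `EFFICIENCY-L6d.md` §10b).  Nothing is run or proved about measures here; the cells are TYPED.
-/

namespace Summit.Ventures.DiscreteObjects.Mahler

open Polynomial Literature.NumberTheory.MahlerMeasure

/-- **Cell `(s, d)` at height bound `h` (typed):** no irreducible, reciprocal, cyclotomic-free integer
polynomial `Q` of degree `d` with `Q(0) ≠ 0` and `height (Φ_s · Q) ≤ h` is sub-Lehmer. -/
def HeightCell (h : ℕ) (s : Multiset ℕ) (d : ℕ) : Prop :=
  ∀ Q : ℤ[X], Q.natDegree = d → Irreducible Q → Q.reverse = Q → Q.coeff 0 ≠ 0 →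
    (∀ m : ℕ, 0 < m → ¬ cyclotomic m ℤ ∣ Q) →
    height ((s.map fun m => cyclotomic m ℤ).prod * Q) ≤ h → ¬ SubLehmer Q

/-- **Rung `N` at height bound `h` (typed):** no integer polynomial of degree `≤ N` and height `≤ h` is
sub-Lehmer. -/
def HeightSubLehmerEmptyUpTo (h N : ℕ) : Prop :=
  ∀ P : ℤ[X], P.natDegree ≤ N → height P ≤ h → ¬ SubLehmer P

/-- At `h = 1` the cells are those of `Height1CensusCells`. -/
theorem heightCell_one_iff (s : Multiset ℕ) (d : ℕ) : HeightCell 1 s d ↔ Height1Cell s d := Iff.rfl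

/-- At `h = 1` the rungs are those of `Height1Ladder`. -/
theorem heightSubLehmerEmptyUpTo_one_iff (N : ℕ) :
    HeightSubLehmerEmptyUpTo 1 N ↔ Height1SubLehmerEmptyUpTo N := Iff.rfl

/-- Rungs are monotone in the degree bound and antitone in the height bound. -/
theorem heightSubLehmerEmptyUpTo_mono {h h' M N : ℕ} (hh : h ≤ h') (hMN : M ≤ N)
    (hyp : HeightSubLehmerEmptyUpTo h' N) : HeightSubLehmerEmptyUpTo h M :=
  fun P hdeg hP => hyp P (le_trans hdeg hMN) (le_trans hP hh)

/-- Cells are antitone in the height bound. -/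
theorem heightCell_mono {h h' : ℕ} (hh : h ≤ h') {s : Multiset ℕ} {d : ℕ} (hyp : HeightCell h' s d) :
    HeightCell h s d :=
  fun Q hd hirr hrev hc0 hncyc hheight => hyp Q hd hirr hrev hc0 hncyc (le_trans hheight hh)

/-- Below degree `56` every rung holds outright ([MRW08, Thm 1.1] as a named fact). -/
theorem heightSubLehmerEmptyUpTo_of_lt_56 (hB : SubLehmerDegreeBound) (h : ℕ) {N : ℕ} (hN : N < 56) :
    HeightSubLehmerEmptyUpTo h N := by
  intro P hdeg _ hP
  have := natDegree_ge_of_subLehmer hB hP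
  omega

/-- **Assembly of rung `N ≤ 60` at height `h` from its own cells (kernel):** conditional on
[MRW08, Thm 1.1] and Smyth's theorem, the cells `HeightCell h s d` with `(s, d)` admissible and
`Σ φ(s) + d ≤ N` imply `HeightSubLehmerEmptyUpTo h N`. -/
theorem heightSubLehmerEmptyUpTo_of_cells (hB : SubLehmerDegreeBound) (hS : NonreciprocalMahlerBound)
    {h N : ℕ} (hN : N ≤ 60)
    (hcells : ∀ (s : Multiset ℕ) (d : ℕ), AdmissibleCell s d → (s.map Nat.totient).sum + d ≤ N →
      HeightCell h s d) :
    HeightSubLehmerEmptyUpTo h N := by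
  intro P hdeg hh hP
  obtain ⟨u, a, s, Q, hu, hs, hPf, hQirr, hQ, _, hrev, hQd, hc0, hncyc, hdegs, _⟩ :=
    subLehmer_degree_le_60_structure hB hS hP (le_trans hdeg hN)
  have hadm : AdmissibleCell s Q.natDegree := ⟨hs, hQd, by omega⟩
  have hhR : height ((s.map fun m => cyclotomic m ℤ).prod * Q) ≤ h := by
    rw [← height_signed_shift hu a, ← mul_assoc, ← hPf]; exact hh
  exact hcells s Q.natDegree hadm (by omega) Q rfl hQirr hrev hc0 hncyc hhR hQ

/-- The same over the explicit list of admissible cells (`Height1CensusCellList.admissibleCellList`). -/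
theorem heightSubLehmerEmptyUpTo_of_cellList (hB : SubLehmerDegreeBound) (hS : NonreciprocalMahlerBound)
    {h N : ℕ} (hN : N ≤ 60)
    (hcells : ∀ p ∈ admissibleCellList, (p.1.map Nat.totient).sum + p.2 ≤ N → HeightCell h p.1 p.2) :
    HeightSubLehmerEmptyUpTo h N :=
  heightSubLehmerEmptyUpTo_of_cells hB hS hN fun s d hsd hle =>
    hcells (s, d) ((admissibleCell_iff_mem s d).mp hsd) hle

/-- **Degree 56 at any height is ONE cell** (kernel): conditional on the named facts,
`HeightCell h ∅ 56` (the CORES cell, e.g. the menu line "height ≤ 2, degree 56" for `h = 2`) gives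
`HeightSubLehmerEmptyUpTo h 56`. -/
theorem heightSubLehmerEmptyUpTo_56_of_cell (hB : SubLehmerDegreeBound) (hS : NonreciprocalMahlerBound)
    {h : ℕ} (hcell : HeightCell h 0 56) : HeightSubLehmerEmptyUpTo h 56 := by
  refine heightSubLehmerEmptyUpTo_of_cells hB hS (by norm_num) fun s d hadm hle => ?_
  obtain ⟨hs, hd, _⟩ := hadm
  -- total degree ≤ 56 with d ≥ 56 forces d = 56 and Σ φ(s) = 0, hence s = ∅ (every φ(m) ≥ 1)
  have hd56 : d = 56 := by omega
  have hsum0 : (s.map Nat.totient).sum = 0 := by omega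
  have hs0 : s = 0 := by
    rcases Multiset.empty_or_exists_mem s with h0 | ⟨m, hm⟩
    · exact h0
    · exfalso
      have hmpos : 0 < m := by
        have := hs m hm
        simp only [Finset.mem_insert, Finset.mem_singleton] at this
        omega
      have hle' : Nat.totient m ≤ (s.map Nat.totient).sum :=
        Multiset.le_sum_of_mem (Multiset.mem_map_of_mem Nat.totient hm)
      have := Nat.totient_pos.mpr hmpos
      omega
  subst hs0; subst hd56
  exact hcell

end Summit.Ventures.DiscreteObjects.Mahler
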